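/-
Copyright: rh-split cell (screw, bridge) gen 19, 2026-08-28.  Splitting search over kernel-typed
RH-equivalences.  A splitting `A ∧ B ⟹ RH` is CONDITIONAL bookkeeping unless `A` and `B` are both
proved; nothing here bears on the truth of RH.
-/
import Summits.RiemannHypothesis.RiemannHypothesis.Theorems.Splittings.SlidingGerm
import Literature.NumberTheory.Sieve.RomanovTheorem

/-!
# «SLIDING THEFT GERM» — part A of 3: the counting hypothesis and the summed slide bound (G2)

Object #10 of the (screw, bridge) seat, second half (lead RULING #462 LANE §25 #10; paper of record: rh-splitx-theory-1
`K7-GERM-PROOF.md` 2fb6d6932f74c7f9).  Builds on `SlidingGerm` (termwise germs, MVT slides, finite sums, abstract law).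

* §7 `CountHyp A γ` — (H1) in FINITARY form: every finite set of indices with ordinates `≤ X` (`X ≥ 2`) has
  `≤ A·X·log X` members (for the zeta ordinates: Riemann–von Mangoldt; here a hypothesis, so no zeta facts enter);
  NEAR count `Σ_{γ_k ≤ X} γ_k ≤ A X² log X`; DYADIC TAIL `Σ_{γ_k > X} γ_k⁻² ≤ 4A(2 + log X)/X` (layer cake over
  shells `(2^j X, 2^{j+1} X]`, `Σ (j+1)/2^j ≤ 4`); hence (G2) SUMMED: every finite partial sum of the slid series is
  `≤ 601·A·η̄·t²·log(1/t)` in absolute value for `0 < t ≤ 1/4` (`abs_sum_slide_le_of_countHyp`), and so is its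
  sum (`abs_slideSum_le_of_countHyp`, limit of partial sums).
* §8 `count_le_of_bounded_sliding` — the no-go with the TOWER SIDE ABSTRACT: a pure sliding identity on `|t| ≤ U`
  plus (G1) `L t² N(1/t) − C t² ≤ Ψ(t)` on `(0, δ]` force `L·N(Y) ≤ 601·A·η̄·log Y + C` for `Y ≥ max(4, 1/U, 1/δ)`.

HONEST LABEL: elementary real/complex analysis and finite-sum bookkeeping; an INSTRUMENT for another seat's
conjecture (rh-idea-4 K7 / theory-1 COUNT THEFT LAW); ζ-free, RH-free; toward RH: 0.
Nothing here bears on the truth of RH.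
-/

set_option linter.dupNamespace false

namespace Summit.RiemannHypothesis.RiemannHypothesis.Theorems.Splittings.SlidingGerm

/-! ## 7. The counting hypothesis (finitary) and the two summations under it -/

/-- **(H1) COUNTING HYPOTHESIS** on a slid sequence, FINITARY form: every finite set of indices whose ordinates are
`≤ X` has at most `A·X·log X` elements (`X ≥ 2`).  For the (injectively indexed) positive ordinates of the
nontrivial zeros of `ζ` this is the Riemann–von Mangoldt bound `N(T) = (T/2π) log(T/2π) − T/2π + O(log T)`; here it
is a HYPOTHESIS, so no zeta facts enter the file. -/
def CountHyp (A : ℝ) (γ : ℕ → ℝ) : Prop :=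
  ∀ X : ℝ, 2 ≤ X → ∀ F : Finset ℕ, (∀ k ∈ F, γ k ≤ X) → (F.card : ℝ) ≤ A * X * Real.log X

/-- The constant of a counting hypothesis is `≥ 0` (test it on the empty set). -/
theorem CountHyp.nonneg {A : ℝ} {γ : ℕ → ℝ} (hA : CountHyp A γ) : 0 ≤ A := by
  have h := hA 2 le_rfl ∅ (by simp)
  simp only [Finset.card_empty, Nat.cast_zero] at h
  have hl : 0 < Real.log 2 := Real.log_pos one_lt_two
  nlinarith

/-- NEAR COUNT: `Σ_{k ∈ F, γ_k ≤ X} γ_k ≤ A·X²·log X`. -/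
theorem sum_near_le_of_countHyp {A X : ℝ} {γ : ℕ → ℝ} (hA : CountHyp A γ) (hX : 2 ≤ X) (F : Finset ℕ) :
    ∑ k ∈ F with γ k ≤ X, γ k ≤ A * X ^ 2 * Real.log X := by
  have hG : ∀ k ∈ F.filter (fun k ↦ γ k ≤ X), γ k ≤ X := fun k hk ↦ (Finset.mem_filter.mp hk).2
  have hX0 : 0 ≤ X := by linarith
  calc ∑ k ∈ F with γ k ≤ X, γ k ≤ ∑ k ∈ F with γ k ≤ X, X := Finset.sum_le_sum hG
    _ = ((F.filter (fun k ↦ γ k ≤ X)).card : ℝ) * X := by rw [Finset.sum_const, nsmul_eq_mul]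
    _ ≤ A * X * Real.log X * X := by gcongr; exact hA X hX _ hG
    _ = A * X ^ 2 * Real.log X := by ring

/-- **DYADIC TAIL COUNT**: for a finite set of indices with ordinates `> X ≥ 2`, `Σ 1/γ_k² ≤ 4A(2 + log X)/X`
(layer-cake over the shells `(2^j X, 2^{j+1} X]`, the counting hypothesis per shell, `Σ (j+1)/2^j ≤ 4`). -/
theorem sum_inv_sq_le_of_countHyp {A X : ℝ} {γ : ℕ → ℝ} (hA : CountHyp A γ) (hX : 2 ≤ X) (F : Finset ℕ)
    (hF : ∀ k ∈ F, X < γ k) :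
    ∑ k ∈ F, 1 / γ k ^ 2 ≤ 4 * A * (2 + Real.log X) / X := by
  classical
  have hXpos : 0 < X := by linarith
  have hA0 : 0 ≤ A := hA.nonneg
  have hlX : 0 ≤ Real.log X := (Real.log_pos (by linarith)).le
  -- shell index of each ordinate
  have hshell : ∀ k ∈ F, ∃ n : ℕ, 2 ^ n * X ≤ γ k ∧ γ k < 2 ^ (n + 1) * X := by
    intro k hk
    have h1 : 1 ≤ γ k / X := by rw [le_div_iff₀ hXpos]; linarith [hF k hk]
    obtain ⟨n, hn, hn'⟩ := exists_nat_pow_near h1 one_lt_two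
    refine ⟨n, ?_, ?_⟩
    · have := mul_le_mul_of_nonneg_right hn hXpos.le
      rwa [div_mul_cancel₀ _ hXpos.ne'] at this
    · have := mul_lt_mul_of_pos_right hn' hXpos
      rwa [div_mul_cancel₀ _ hXpos.ne'] at this
  choose! n hn using hshell
  set J := F.sup n + 1 with hJ
  have hnJ : ∀ k ∈ F, n k < J := fun k hk ↦ Nat.lt_succ_of_le (Finset.le_sup hk)
  -- layer cake, termwise
  set w : ℕ → ℕ → ℝ := fun k j ↦ if γ k < 2 ^ (j + 1) * X then 1 / (4 ^ j * X ^ 2) else 0 with hw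
  have hw0 : ∀ k j, 0 ≤ w k j := fun k j ↦ by simp only [hw]; split_ifs <;> positivity
  have hterm : ∀ k ∈ F, 1 / γ k ^ 2 ≤ ∑ j ∈ Finset.range J, w k j := by
    intro k hk
    have h2n : 0 < (2 : ℝ) ^ n k * X := by positivity
    calc 1 / γ k ^ 2 ≤ 1 / (2 ^ n k * X) ^ 2 := by
          gcongr
          exact (hn k hk).1
      _ = w k (n k) := by
          simp only [hw, if_pos (hn k hk).2]
          congr 1
          rw [mul_pow, ← pow_mul, show (2 : ℝ) ^ (n k * 2) = 4 ^ n k by rw [mul_comm, pow_mul]; norm_num]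
      _ ≤ ∑ j ∈ Finset.range J, w k j :=
          Finset.single_le_sum (fun j _ ↦ hw0 k j) (Finset.mem_range.mpr (hnJ k hk))
  -- per-shell count under (H1)
  have hcount : ∀ j : ℕ, (((F.filter (fun k ↦ γ k < 2 ^ (j + 1) * X)).card : ℝ)) ≤
      A * (2 ^ (j + 1) * X) * ((j + 1) + Real.log X) := by
    intro j
    have h2 : (2 : ℝ) ≤ 2 ^ (j + 1) * X := by
      calc (2 : ℝ) ≤ X := hX
        _ = 1 * X := (one_mul X).symm
        _ ≤ 2 ^ (j + 1) * X := by gcongr; exact one_le_pow₀ (by norm_num)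
    have hlog : Real.log (2 ^ (j + 1) * X) ≤ (j + 1) + Real.log X := by
      rw [Real.log_mul (by positivity) hXpos.ne', Real.log_pow]
      push_cast
      have h2 := Real.log_two_lt_d9
      have : ((j : ℝ) + 1) * Real.log 2 ≤ (j + 1) * 1 := by gcongr; linarith
      linarith
    calc (((F.filter (fun k ↦ γ k < 2 ^ (j + 1) * X)).card : ℝ))
        ≤ A * (2 ^ (j + 1) * X) * Real.log (2 ^ (j + 1) * X) :=
          hA _ h2 _ fun k hk ↦ (Finset.mem_filter.mp hk).2.le
      _ ≤ A * (2 ^ (j + 1) * X) * ((j + 1) + Real.log X) := by gcongr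
  calc ∑ k ∈ F, 1 / γ k ^ 2
      ≤ ∑ k ∈ F, ∑ j ∈ Finset.range J, w k j := Finset.sum_le_sum hterm
    _ = ∑ j ∈ Finset.range J,
          (((F.filter (fun k ↦ γ k < 2 ^ (j + 1) * X)).card : ℝ)) * (1 / (4 ^ j * X ^ 2)) := by
        rw [Finset.sum_comm]
        refine Finset.sum_congr rfl fun j _ ↦ ?_
        simp only [hw]
        rw [Finset.sum_ite, Finset.sum_const_zero, add_zero, Finset.sum_const, nsmul_eq_mul]
    _ ≤ ∑ j ∈ Finset.range J, A * (2 ^ (j + 1) * X) * ((j + 1) + Real.log X) * (1 / (4 ^ j * X ^ 2)) := by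
        gcongr with j hj
        exact hcount j
    _ = 2 * A / X * ∑ j ∈ Finset.range J, (((j : ℝ) + 1) / 2 ^ j + Real.log X * (1 / 2 ^ j)) := by
        rw [Finset.mul_sum]
        refine Finset.sum_congr rfl fun j _ ↦ ?_
        rw [pow_succ, show (4 : ℝ) ^ j = 2 ^ j * 2 ^ j by rw [← mul_pow]; norm_num]
        field_simp
    _ ≤ 2 * A / X * (4 + Real.log X * 2) := by
        gcongr
        rw [Finset.sum_add_distrib, ← Finset.mul_sum]
        gcongr
        · exact Literature.NumberTheory.Sieve.Romanov.sum_range_succ_div_two_pow_le J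
        · simpa [one_div_pow] using sum_geometric_two_le J
    _ = 4 * A * (2 + Real.log X) / X := by ring

/-- **(G2) SUMMED, finitary.**  Under the counting hypothesis, slides `|η_k| ≤ η̄ ≤ 1/2` of ordinates `γ_k ≥ 1`
change every FINITE partial sum of the window trace by at most `601·A·η̄·t²·log(1/t)` for `0 < t ≤ 1/4`
(near set `γ_k ≤ 2/(3t)`: weight `γ_k t⁴`, total `≤ (2/5)A t² log(1/t)`; far set: dyadic tail, total
`≤ 240 A t² (2 + log(1/t)) ≤ 600 A t² log(1/t)` as `log(1/t) ≥ log 4 ≥ 4/3`). -/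
theorem abs_sum_slide_le_of_countHyp {A ηbar t : ℝ} {γ η : ℕ → ℝ} (hA : CountHyp A γ) (hγ : ∀ k, 1 ≤ γ k)
    (hη : ∀ k, |η k| ≤ ηbar) (hηbar : ηbar ≤ 1 / 2) (ht : 0 < t) (ht4 : t ≤ 1 / 4) (F : Finset ℕ) :
    |∑ k ∈ F, (pairTrace (γ k + η k) t - pairTrace (γ k) t)| ≤ 601 * A * ηbar * t ^ 2 * Real.log (1 / t) := by
  have hA0 : 0 ≤ A := hA.nonneg
  have hηbar0 : 0 ≤ ηbar := le_trans (abs_nonneg _) (hη 0)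
  set X := 2 / (3 * t) with hX
  have hX2 : 2 ≤ X := by
    rw [hX, le_div_iff₀ (by positivity)]; nlinarith
  have hXpos : 0 < X := by linarith
  have h1 := abs_sum_slide_le F γ η ht.le (fun k _ ↦ by linarith [hγ k])
    (fun k _ ↦ by linarith [hη k, hγ k]) (fun k _ ↦ hη k)
  have hiff : ∀ k, γ k ≤ X ↔ γ k * t ≤ 2 / 3 := fun k ↦ by
    rw [hX, le_div_iff₀ (by positivity)]; constructor <;> intro h <;> nlinarith
  have hnear : ∑ k ∈ F with γ k * t ≤ 2 / 3, γ k ≤ A * X ^ 2 * Real.log X := by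
    have : F.filter (fun k ↦ γ k * t ≤ 2 / 3) = F.filter (fun k ↦ γ k ≤ X) :=
      Finset.filter_congr fun k _ ↦ (hiff k).symm
    rw [this]
    exact sum_near_le_of_countHyp hA hX2 F
  have hfar : ∑ k ∈ F with ¬ γ k * t ≤ 2 / 3, 1 / γ k ^ 2 ≤ 4 * A * (2 + Real.log X) / X := by
    refine sum_inv_sq_le_of_countHyp hA hX2 _ fun k hk ↦ ?_
    have hk' := (Finset.mem_filter.mp hk).2
    rw [← hiff k] at hk'
    exact lt_of_not_ge hk'
  have hlt : Real.log X ≤ Real.log (1 / t) := by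
    refine Real.log_le_log hXpos ?_
    rw [hX, div_le_div_iff₀ (by positivity) ht]
    nlinarith
  have hℓ : 4 / 3 ≤ Real.log (1 / t) := by
    have h4 : Real.log 4 ≤ Real.log (1 / t) := by
      refine Real.log_le_log (by norm_num) ?_
      rw [le_div_iff₀ ht]; linarith
    have h2 := Real.log_two_gt_d9
    have : Real.log 4 = 2 * Real.log 2 := by
      rw [show (4 : ℝ) = 2 ^ 2 by norm_num, Real.log_pow]; push_cast; ring
    linarith
  have hlX : 0 ≤ Real.log X := (Real.log_pos (by linarith)).le
  calc |∑ k ∈ F, (pairTrace (γ k + η k) t - pairTrace (γ k) t)|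
      ≤ ηbar * (9 / 10 * t ^ 4 * (A * X ^ 2 * Real.log X)
               + 40 * t * (4 * A * (2 + Real.log X) / X)) := by
        refine h1.trans ?_
        gcongr
    _ = ηbar * A * t ^ 2 * (2 / 5 * Real.log X + 240 * (2 + Real.log X)) := by
        rw [hX]
        field_simp
        ring
    _ ≤ ηbar * A * t ^ 2 * (2 / 5 * Real.log (1 / t) + 240 * (3 / 2 * Real.log (1 / t) + Real.log (1 / t))) := by
        gcongr
        linarith
    _ = 3002 / 5 * A * ηbar * t ^ 2 * Real.log (1 / t) := by ring
    _ ≤ 601 * A * ηbar * t ^ 2 * Real.log (1 / t) := by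
        have : 0 ≤ A * ηbar * t ^ 2 * Real.log (1 / t) := by
          have : 0 ≤ Real.log (1 / t) := by linarith
          positivity
        nlinarith

/-- From finite partial sums to the series: a bound on every partial sum bounds the sum. -/
theorem abs_le_of_hasSum_of_sum_le {f : ℕ → ℝ} {s M : ℝ} (hs : HasSum f s)
    (hM : ∀ F : Finset ℕ, |∑ k ∈ F, f k| ≤ M) : |s| ≤ M :=
  le_of_tendsto' ((continuous_abs.tendsto s).comp hs) fun F ↦ hM F

/-- **(G2) SUMMED.**  If the slid series has a sum `s(t)` (as in a sliding theft), then
`|s(t)| ≤ 601·A·η̄·t²·log(1/t)` for `0 < t ≤ 1/4`. -/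
theorem abs_slideSum_le_of_countHyp {A ηbar t s : ℝ} {γ η : ℕ → ℝ} (hA : CountHyp A γ) (hγ : ∀ k, 1 ≤ γ k)
    (hη : ∀ k, |η k| ≤ ηbar) (hηbar : ηbar ≤ 1 / 2) (ht : 0 < t) (ht4 : t ≤ 1 / 4)
    (hs : HasSum (fun k ↦ pairTrace (γ k + η k) t - pairTrace (γ k) t) s) :
    |s| ≤ 601 * A * ηbar * t ^ 2 * Real.log (1 / t) :=
  abs_le_of_hasSum_of_sum_le hs fun F ↦ abs_sum_slide_le_of_countHyp hA hγ hη hηbar ht ht4 F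

/-! ## 8. The no-go with the tower side abstract: bounded sliding against (G1) -/

/-- **BOUNDED SLIDING vs. AN UNRESOLVED COUNT (abstract tower side).**  Let the slid sequence satisfy (H1) with
constant `A`, `γ_k ≥ 1`, `|η_k| ≤ η̄ ≤ 1/2`, and let the slid series sum to `−Ψ(t)` on the window `|t| ≤ U`
(PURE SLIDING IDENTITY).  If the stolen-from function obeys (G1) `L·t²·N(1/t) − C·t² ≤ Ψ(t)` on `(0, δ]`, then
for every height `Y ≥ max(4, 1/U, 1/δ)`:  `L·N(Y) ≤ 601·A·η̄·log Y + C`. -/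
theorem count_le_of_bounded_sliding {A ηbar U L C δ : ℝ} {γ η : ℕ → ℝ} {Ψ N : ℝ → ℝ}
    (hA : CountHyp A γ) (hγ : ∀ k, 1 ≤ γ k) (hη : ∀ k, |η k| ≤ ηbar) (hηbar : ηbar ≤ 1 / 2) (hU : 0 < U)
    (hid : ∀ t, |t| ≤ U → HasSum (fun k ↦ pairTrace (γ k + η k) t - pairTrace (γ k) t) (-Ψ t))
    (hδ : 0 < δ) (hG1 : ∀ t ∈ Set.Ioc 0 δ, L * t ^ 2 * N (1 / t) - C * t ^ 2 ≤ Ψ t)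
    {Y : ℝ} (hY4 : 4 ≤ Y) (hYU : 1 / U ≤ Y) (hYδ : 1 / δ ≤ Y) :
    L * N Y ≤ 601 * A * ηbar * Real.log Y + C := by
  set δ' := min δ (min U (1 / 4)) with hδ'
  have hδ'pos : 0 < δ' := by positivity
  have hmem : ∀ t ∈ Set.Ioc 0 δ', t ≤ δ ∧ t ≤ U ∧ t ≤ 1 / 4 := fun t ht ↦
    ⟨ht.2.trans (min_le_left _ _), ht.2.trans ((min_le_right _ _).trans (min_le_left _ _)),
      ht.2.trans ((min_le_right _ _).trans (min_le_right _ _))⟩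
  have hlaw := count_theft_law (L := L) (C := C) (K := 601 * A) (D := 0) (ηbar := ηbar) (δ := δ')
    (N := N) (R := fun _ ↦ 0) (Ψ := Ψ) (S := fun t ↦ -Ψ t) (Rm := fun _ ↦ 0) hδ'pos
    (fun t ht ↦ hG1 t ⟨ht.1, (hmem t ht).1⟩)
    (fun t ht ↦ by
      have hb := abs_slideSum_le_of_countHyp hA hγ hη hηbar ht.1 (hmem t ht).2.2
        (hid t (by rw [abs_of_pos ht.1]; exact (hmem t ht).2.1))
      calc |(-Ψ t)| ≤ 601 * A * ηbar * t ^ 2 * Real.log (1 / t) := hb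
        _ = 601 * A * ηbar * t ^ 2 * Real.log (1 / t) := rfl)
    (fun t _ ↦ by simp) (fun t _ ↦ by simp)
    (Y := Y) (by
      have hYpos : 0 < Y := by linarith
      refine (one_div_le hδ'pos hYpos).mpr (le_min ?_ (le_min ?_ ?_))
      · exact (one_div_le hYpos hδ).mpr hYδ
      · exact (one_div_le hYpos hU).mpr hYU
      · exact one_div_le_one_div_of_le (by norm_num) hY4)
  simpa using hlaw

end Summit.RiemannHypothesis.RiemannHypothesis.Theorems.Splittings.SlidingGerm
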